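import Mathlib
import Summits.ValiantsHypothesis.ValiantsHypothesis.Theorems.GeneratorObstructionsPowGenDegreeQPRowTwoReduction
import Summits.ValiantsHypothesis.ValiantsHypothesis.Theorems.GeneratorObstructionsPowGenDegreeQPTraceTwoDiagonal
import Summits.ValiantsHypothesis.ValiantsHypothesis.Theorems.GeneratorObstructionsPowGenDegreeQPQuadricGram

/-!
# K2 `PowGenDegreeQP` (stmt-ValiantsHypothesis-11655), line `trace-side-regimes`, row `m = 2`:
# Cholesky factorisation on final segments and the Borel density of a full-rank diagonal quadric
# (input `hdense`)

Helper file (`--supports stmt-ValiantsHypothesis-11655`).  The last of the three inputs of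
`…PowGenDegreeQPRowTwoReduction.rowTwo_bound_of_sign_of_fund` for the row `m = 2` (quadrics) of the
window of K2: the Borel density `hdense` ((i) + `hsign`: `…TraceTwoDiagonal`; `hfund`:
`…QuadricGram`).

* §1 `cholesky_aux` / `exists_blockTriangular_mul_diagonal_mul_transpose_eq` — CHOLESKY (`LDLᵀ`)
  FACTORISATION ON FINAL SEGMENTS over an algebraically closed field: a symmetric matrix whose
  principal minors on the final segments `{u ≥ t}` are all nonzero is `b · diag(c) · bᵀ` with `b`
  upper triangular with nonzero diagonal, for any prescribed nonzero diagonal `c` (induction on the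
  number of letters, removing the least letter; the corner entry is nonzero because `det ≠ 0`).
* §2 `hdense_of_linSubstRep_eq_diagonal` — if `h₀ · f = ∑ c_u X_u²` (all `c_u ≠ 0`) then a class of
  `k[Δ_2 f]` vanishing at all Borel translates `(b h₀) · f` is zero: with `Ψ(A) = F(A · h₀f)` (the
  generic orbit map) and `μ(A) = ∏_t det((A diag(c) Aᵀ)|_{≥t})`, Cholesky gives `Ψ μ ≡ 0` on matrix
  space, `μ(1) ≠ 0`, so `Ψ = 0`, i.e. `F` vanishes on `GL · f`.  `hdense_powFormLex_two`: the case
  `f = tr X_n²` over `ℂ` at the `h₀` of `exists_gl_powFormLex_two_eq_diagonal`.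

With this file all three inputs of the row `m = 2` are discharged; the assembled row
(`powGenDegreeQP_rowTwo`, stubs ⟺ stubs on rows `m ≥ 3`) is the sibling file `…PowGenDegreeQPRowTwo`.
Honest label: classical (quadrics form a spherical orbit closure); rows `m ≥ 3` of both registered
stubs OPEN.
-/

namespace Summit.ValiantsHypothesis.ValiantsHypothesis.Theorems.GeneratorObstructions.PowGenDegreeQP

open MvPolynomial
open scoped Matrix
open Literature.NumberTheory.DiophantineGeometry Literature.Computability.AlgebraicComplexity

-- `Summit.ValiantsHypothesis.ValiantsHypothesis.…` is the tree's mandated single-conjunct layout.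
set_option linter.dupNamespace false

noncomputable section

universe u v

/-! ## 1. Cholesky factorisation `S = b · diag(c) · bᵀ` with `b` upper triangular -/

section Cholesky

/-- Entries of `B · diag(d) · Bᵀ`: `∑_u B_{au} d_u B_{a'u}`. [folklore] -/
theorem mul_diagonal_mul_transpose_apply {τ : Type u} {R : Type v} [Fintype τ] [DecidableEq τ]
    [CommRing R] (B : Matrix τ τ R) (d : τ → R) (a a' : τ) :
    (B * Matrix.diagonal d * Bᵀ) a a' = ∑ u, B a u * d u * B a' u := by
  rw [Matrix.mul_apply]
  refine Finset.sum_congr rfl fun u _ => ?_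
  rw [Matrix.mul_diagonal, Matrix.transpose_apply]

/-- **Cholesky / `LDLᵀ` factorisation on final segments** (induction on the number of letters):
over an algebraically closed field, a symmetric matrix all of whose principal minors on the final
segments `{u ≥ t}` are nonzero is `b · diag(c) · bᵀ` for an upper triangular `b` with nonzero
diagonal, for any prescribed nonzero diagonal `c` (remove the least letter `t₀`, factor the
remaining block by induction, solve a triangular system for the first row, take a square root for
the corner; the corner entry is nonzero because `det S ≠ 0`). Horn–Johnson, *Matrix Analysis*,
§4.1 / Cor. 3.5.6 (LDU of matrices with nonzero leading minors), mirrored to final segments.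
[folklore] -/
theorem cholesky_aux {k : Type v} [Field k] [IsAlgClosed k] :
    ∀ (n : ℕ) (σ : Type u) [Fintype σ] [LinearOrder σ], Fintype.card σ = n →
      ∀ (c : σ → k), (∀ u, c u ≠ 0) → ∀ S : Matrix σ σ k, S.IsSymm →
        (∀ t : σ, (S.submatrix (fun u : {u : σ // t ≤ u} => u.1) (fun u => u.1)).det ≠ 0) →
          ∃ b : Matrix σ σ k, b.BlockTriangular id ∧ (∀ u, b u u ≠ 0) ∧
            b * Matrix.diagonal c * bᵀ = S := by
  intro n
  induction n with
  | zero =>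
    intro σ _ _ hcard c hc S hS hmin
    haveI : IsEmpty σ := Fintype.card_eq_zero_iff.mp hcard
    exact ⟨1, Matrix.blockTriangular_one, fun u => isEmptyElim u, Subsingleton.elim _ _⟩
  | succ n ih =>
    intro σ _ _ hcard c hc S hS hmin
    have hne : Nonempty σ := Fintype.card_pos_iff.mp (by omega)
    obtain ⟨t₀, ht₀le⟩ : ∃ t₀ : σ, ∀ u, t₀ ≤ u :=
      ⟨Finset.univ.min' Finset.univ_nonempty, fun u => Finset.min'_le _ _ (Finset.mem_univ u)⟩
    -- the remaining letters
    have hcard' : Fintype.card {u : σ // u ≠ t₀} = n := by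
      have h1 := Fintype.card_subtype_compl (fun u : σ => u = t₀)
      rw [Fintype.card_subtype_eq, hcard] at h1
      simpa using h1
    -- final segments of the remaining letters are final segments
    let e : ∀ t' : {u : σ // u ≠ t₀},
        {u : {u : σ // u ≠ t₀} // t' ≤ u} ≃ {u : σ // t'.1 ≤ u} := fun t' =>
      { toFun := fun u => ⟨u.1.1, u.2⟩
        invFun := fun v => ⟨⟨v.1, fun hv => t'.2 (le_antisymm (v.2.trans_eq hv) (ht₀le _))⟩, v.2⟩
        left_inv := fun u => rfl
        right_inv := fun v => rfl }
    obtain ⟨b', hb'tri, hb'diag, hb'eq⟩ := ih {u : σ // u ≠ t₀} hcard' (fun u => c u.1)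
      (fun u => hc u.1) (S.submatrix (fun u => u.1) (fun u => u.1)) (hS.submatrix _) (fun t' => by
        rw [show (S.submatrix (fun u : {u : σ // u ≠ t₀} => u.1) (fun u => u.1)).submatrix
            (fun u : {u : {u : σ // u ≠ t₀} // t' ≤ u} => u.1) (fun u => u.1) =
            (S.submatrix (fun u : {u : σ // t'.1 ≤ u} => u.1) (fun u => u.1)).submatrix
              (e t') (e t') from rfl, Matrix.det_submatrix_equiv_self]
        exact hmin t'.1)
    -- the triangular system for the first row
    set A' : Matrix {u : σ // u ≠ t₀} {u : σ // u ≠ t₀} k :=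
      b' * Matrix.diagonal (fun u => c u.1) with hA'
    have hdetA' : A'.det ≠ 0 := by
      rw [hA', Matrix.det_mul, Matrix.det_of_upperTriangular hb'tri, Matrix.det_diagonal]
      exact mul_ne_zero (Finset.prod_ne_zero_iff.mpr fun u _ => hb'diag u)
        (Finset.prod_ne_zero_iff.mpr fun u _ => hc u.1)
    set w : {u : σ // u ≠ t₀} → k := A'⁻¹ *ᵥ fun u => S t₀ u.1 with hw
    have hAw : A' *ᵥ w = fun u => S t₀ u.1 := by
      rw [hw, Matrix.mulVec_mulVec, Matrix.mul_nonsing_inv _ (isUnit_iff_ne_zero.mpr hdetA'),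
        Matrix.one_mulVec]
    have hAw' : ∀ a : {u : σ // u ≠ t₀}, ∑ u, w u * c u.1 * b' a u = S t₀ a.1 := by
      intro a
      have h1 := congr_fun hAw a
      simp only [Matrix.mulVec, dotProduct, hA', Matrix.mul_diagonal] at h1
      rw [← h1]
      exact Finset.sum_congr rfl fun u _ => by ring
    -- the corner
    obtain ⟨β, hβ⟩ := IsAlgClosed.exists_pow_nat_eq
      ((S t₀ t₀ - ∑ u : {u : σ // u ≠ t₀}, w u * c u.1 * w u) / c t₀) two_pos
    -- the factor
    let b : Matrix σ σ k := Matrix.of fun a u =>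
      if ha : a = t₀ then (if hu : u = t₀ then β else w ⟨u, hu⟩)
      else (if hu : u = t₀ then 0 else b' ⟨a, ha⟩ ⟨u, hu⟩)
    have hb_t₀t₀ : b t₀ t₀ = β := by simp [b]
    have hb_t₀ : ∀ u : {u : σ // u ≠ t₀}, b t₀ u.1 = w u := fun u => by simp [b, u.2]
    have hb_0 : ∀ a : σ, a ≠ t₀ → b a t₀ = 0 := fun a ha => by simp [b, ha]
    have hb' : ∀ (a : σ) (ha : a ≠ t₀) (u : {u : σ // u ≠ t₀}), b a u.1 = b' ⟨a, ha⟩ u :=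
      fun a ha u => by simp [b, ha, u.2]
    have htri : b.BlockTriangular id := by
      intro i j hij
      change j < i at hij
      by_cases hi : i = t₀
      · exact absurd (hi ▸ hij) (not_lt.mpr (ht₀le j))
      · by_cases hj : j = t₀
        · rw [hj]; exact hb_0 i hi
        · exact (hb' i hi ⟨j, hj⟩).trans
            (hb'tri (show (⟨j, hj⟩ : {u : σ // u ≠ t₀}) < ⟨i, hi⟩ from hij))
    have hprod : b * Matrix.diagonal c * bᵀ = S := by
      ext a a'
      rw [mul_diagonal_mul_transpose_apply, Fintype.sum_eq_add_sum_subtype_ne _ t₀]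
      by_cases ha : a = t₀
      · subst ha
        by_cases ha' : a' = a
        · subst ha'
          rw [hb_t₀t₀]
          simp only [hb_t₀]
          rw [show β * c a' * β = β ^ 2 * c a' by ring, hβ, div_mul_cancel₀ _ (hc a')]
          ring
        · rw [hb_t₀t₀, hb_0 a' ha', mul_zero, zero_add,
            Finset.sum_congr rfl fun u _ => by rw [hb_t₀, hb' a' ha']]
          exact hAw' ⟨a', ha'⟩
      · by_cases ha' : a' = t₀
        · subst ha'
          rw [hb_t₀t₀, hb_0 a ha, zero_mul, zero_mul, zero_add,
            Finset.sum_congr rfl fun u _ => by rw [hb_t₀, hb' a ha], hS.apply, ← hAw' ⟨a, ha⟩]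
          exact Finset.sum_congr rfl fun u _ => by ring
        · rw [hb_0 a ha, zero_mul, zero_mul, zero_add,
            Finset.sum_congr rfl fun u _ => by rw [hb' a ha, hb' a' ha']]
          have h1 := congr_fun (congr_fun hb'eq ⟨a, ha⟩) ⟨a', ha'⟩
          rw [mul_diagonal_mul_transpose_apply, Matrix.submatrix_apply] at h1
          exact h1
    refine ⟨b, htri, fun u => ?_, hprod⟩
    by_cases hu : u = t₀
    · subst hu
      rw [hb_t₀t₀]
      intro hβ0
      have hdetS : S.det ≠ 0 := by
        have h1 := hmin u
        rwa [show (S.submatrix (fun v : {v : σ // u ≤ v} => v.1) (fun v => v.1)) =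
          S.submatrix (Equiv.subtypeUnivEquiv ht₀le) (Equiv.subtypeUnivEquiv ht₀le) from rfl,
          Matrix.det_submatrix_equiv_self] at h1
      apply hdetS
      rw [← hprod, Matrix.det_mul, Matrix.det_mul, Matrix.det_of_upperTriangular htri,
        Finset.prod_eq_zero (f := fun i => b i i) (Finset.mem_univ u) (hb_t₀t₀.trans hβ0)]
      ring
    · rw [hb' u hu ⟨u, hu⟩]
      exact hb'diag ⟨u, hu⟩

/-- **Cholesky factorisation on final segments** (packaged): over an algebraically closed field,
every symmetric matrix with nonzero final-segment principal minors is `b · diag(c) · bᵀ` with `b`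
upper triangular with nonzero diagonal, for any nonzero diagonal `c`. Horn–Johnson §4.1. [folklore] -/
theorem exists_blockTriangular_mul_diagonal_mul_transpose_eq {σ : Type u} {k : Type v} [Fintype σ]
    [LinearOrder σ] [Field k] [IsAlgClosed k] (c : σ → k) (hc : ∀ u, c u ≠ 0) (S : Matrix σ σ k)
    (hS : S.IsSymm)
    (hmin : ∀ t : σ, (S.submatrix (fun u : {u : σ // t ≤ u} => u.1) (fun u => u.1)).det ≠ 0) :
    ∃ b : Matrix σ σ k, b.BlockTriangular id ∧ (∀ u, b u u ≠ 0) ∧ b * Matrix.diagonal c * bᵀ = S :=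
  cholesky_aux (Fintype.card σ) σ rfl c hc S hS hmin

end Cholesky

/-! ## 2. Borel density of a full-rank diagonal quadric -/

section Density

variable {σ : Type u} {k : Type v} [Fintype σ] [LinearOrder σ] [Field k]

/-- Evaluating the product of the final-segment principal minors of `Y · diag(c) · Yᵀ` (`Y` the
generic matrix) at a matrix `A`. [folklore] -/
theorem eval_prod_det_submatrix_generic (c : σ → k) (A : Matrix σ σ k) :
    eval (fun ij : σ × σ => A ij.1 ij.2)
      (∏ t : σ, ((Matrix.mvPolynomialX σ σ k * Matrix.diagonal (fun u => C (c u)) *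
        (Matrix.mvPolynomialX σ σ k)ᵀ).submatrix (fun u : {u : σ // t ≤ u} => u.1)
          (fun u : {u : σ // t ≤ u} => u.1)).det) =
      ∏ t : σ, ((A * Matrix.diagonal c * Aᵀ).submatrix (fun u : {u : σ // t ≤ u} => u.1)
        (fun u : {u : σ // t ≤ u} => u.1)).det := by
  rw [map_prod]
  refine Finset.prod_congr rfl fun t _ => ?_
  rw [RingHom.map_det, RingHom.mapMatrix_apply, ← Matrix.submatrix_map, Matrix.map_mul,
    Matrix.map_mul, Matrix.transpose_map, ← RingHom.mapMatrix_apply,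
    Matrix.mvPolynomialX_mapMatrix_eval, Matrix.diagonal_map (map_zero _)]
  have hc' : (fun m => (eval fun ij : σ × σ => A ij.1 ij.2) (C (c m))) = c :=
    funext fun m => eval_C _
  rw [hc']

/-- **Borel density of a full-rank diagonal quadric** (input `hdense` of
`rowTwo_bound_of_sign_of_fund`, general form): over an algebraically closed field, if
`h₀ · f = ∑_u c_u X_u²` with all `c_u ≠ 0`, then a class of `k[Δ_2 f]` vanishing at every Borel
translate `(b h₀) · f`, `b` upper triangular, is zero.  Proof: `A · (∑ c_u X_u²) = ∑ (A diag(c) Aᵀ)_{ab}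
X_a X_b`; whenever the final-segment minors of `A diag(c) Aᵀ` are nonzero, Cholesky gives an upper
triangular `b` with `A · f' = b · f'`, so the polynomial `A ↦ F(A · f')` times the minors polynomial
vanishes identically on matrix space, and the latter is nonzero (value at `A = 1`).
Vinberg–Kimel'fel'd 1978 (quadrics are a spherical orbit closure); Horn–Johnson §4.1. [folklore] -/
theorem hdense_of_linSubstRep_eq_diagonal [IsAlgClosed k] (f : MvPolynomial σ k) (h₀ : GL σ k)
    (c : σ → k) (hc : ∀ u, c u ≠ 0)
    (h : linSubstRep σ k h₀ f = ∑ u, c u • (X u : MvPolynomial σ k) ^ 2)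
    (x : OrbitCoordRing f 2)
    (hx : ∀ b : GL σ k, IsUpperTriangular b →
      evalAtPoint f 2 (orbitCoordRep f 2 (b * h₀)⁻¹ x) = 0) :
    x = 0 := by
  classical
  obtain ⟨F, rfl⟩ := Ideal.Quotient.mk_surjective x
  set f' : MvPolynomial σ k := ∑ u, c u • (X u : MvPolynomial σ k) ^ 2 with hf'
  -- values at the Borel translates of `f' = h₀ · f`
  have hF : ∀ b : GL σ k, IsUpperTriangular b →
      aeval (formCoeff 2 (linSubst σ k (b : Matrix σ σ k) f')) F = 0 := by
    intro b hb
    have h1 := hx b hb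
    rwa [evalAtPoint_orbitCoordRep_inv_mk, map_mul, Module.End.mul_apply, h, linSubstRep_apply]
      at h1
  -- the orbit-map polynomial `Ψ(A) = F(A · f')` and the minors polynomial `μ`
  set Ψ : MvPolynomial (σ × σ) k := genericOrbitMap f' 2 F with hΨ
  set μ : MvPolynomial (σ × σ) k := ∏ t : σ, ((Matrix.mvPolynomialX σ σ k *
      Matrix.diagonal (fun u => C (c u)) * (Matrix.mvPolynomialX σ σ k)ᵀ).submatrix
        (fun u : {u : σ // t ≤ u} => u.1) (fun u : {u : σ // t ≤ u} => u.1)).det with hμ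
  have hμeval : ∀ A : Matrix σ σ k, eval (fun ij : σ × σ => A ij.1 ij.2) μ =
      ∏ t : σ, ((A * Matrix.diagonal c * Aᵀ).submatrix (fun u : {u : σ // t ≤ u} => u.1)
        (fun u : {u : σ // t ≤ u} => u.1)).det := fun A => eval_prod_det_submatrix_generic c A
  have hΨeval : ∀ A : Matrix σ σ k, eval (fun ij : σ × σ => A ij.1 ij.2) Ψ =
      aeval (formCoeff 2 (linSubst σ k A f')) F := fun A => eval_genericOrbitMap f' 2 F A
  -- `Ψ μ` vanishes at every matrix
  have hzero : Ψ * μ = 0 := by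
    apply MvPolynomial.funext
    intro a
    rw [map_zero, map_mul]
    set A : Matrix σ σ k := Matrix.of fun i j => a (i, j) with hA
    have ha : a = fun ij : σ × σ => A ij.1 ij.2 := by funext ij; rfl
    rw [ha, hΨeval, hμeval]
    by_cases hmin : ∀ t : σ, ((A * Matrix.diagonal c * Aᵀ).submatrix
        (fun u : {u : σ // t ≤ u} => u.1) (fun u : {u : σ // t ≤ u} => u.1)).det ≠ 0
    · have hsymm : (A * Matrix.diagonal c * Aᵀ).IsSymm := by
        rw [Matrix.IsSymm, Matrix.transpose_mul, Matrix.transpose_mul, Matrix.transpose_transpose,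
          Matrix.diagonal_transpose, ← Matrix.mul_assoc]
      obtain ⟨b, hbtri, hbdiag, hbeq⟩ :=
        exists_blockTriangular_mul_diagonal_mul_transpose_eq c hc _ hsymm hmin
      have hdetb : b.det ≠ 0 := by
        rw [Matrix.det_of_upperTriangular hbtri]
        exact Finset.prod_ne_zero_iff.mpr fun u _ => hbdiag u
      have hval : linSubst σ k A f' =
          linSubst σ k (Matrix.GeneralLinearGroup.mkOfDetNeZero b hdetb : Matrix σ σ k) f' := by
        rw [Matrix.GeneralLinearGroup.val_mkOfDetNeZero, hf', sum_smul_X_sq_eq_quadric,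
          linSubst_quadric, linSubst_quadric, hbeq]
      have hbU : IsUpperTriangular (Matrix.GeneralLinearGroup.mkOfDetNeZero b hdetb) := by
        change (Matrix.GeneralLinearGroup.mkOfDetNeZero b hdetb : Matrix σ σ k).BlockTriangular id
        rw [Matrix.GeneralLinearGroup.val_mkOfDetNeZero]
        exact hbtri
      rw [hval, hF _ hbU, zero_mul]
    · push Not at hmin
      obtain ⟨t, ht⟩ := hmin
      rw [Finset.prod_eq_zero (Finset.mem_univ t) ht, mul_zero]
  -- `μ ≠ 0` (value at `A = 1`), hence `Ψ = 0`
  have hμ0 : μ ≠ 0 := by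
    intro h0
    have h1 := hμeval 1
    rw [h0, map_zero, Matrix.one_mul, Matrix.transpose_one, Matrix.mul_one] at h1
    refine (Finset.prod_ne_zero_iff.mpr fun t _ => ?_) h1.symm
    rw [Matrix.submatrix_diagonal _ _ Subtype.val_injective, Matrix.det_diagonal]
    exact Finset.prod_ne_zero_iff.mpr fun u _ => hc u.1
  have hΨ0 : Ψ = 0 := (mul_eq_zero.mp hzero).resolve_right hμ0
  -- so `F` vanishes on the whole orbit `GL · f = GL · f'`
  rw [Ideal.Quotient.eq_zero_iff_mem, mem_orbitVanishingIdeal_iff]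
  intro g
  have hf0 : linSubstRep σ k h₀⁻¹ f' = f := by
    rw [← h, ← Module.End.mul_apply, ← map_mul, inv_mul_cancel, map_one, Module.End.one_apply]
  have hgf : linSubstRep σ k g f = linSubst σ k ((g * h₀⁻¹ : GL σ k) : Matrix σ σ k) f' := by
    rw [← linSubstRep_apply, map_mul, Module.End.mul_apply, hf0]
  rw [hgf, ← hΨeval, hΨ0, map_zero]

/-- **`hdense` for `tr X_n²`** over `ℂ`: at any `h₀` with `h₀ · tr X_n² = ∑_u c_u X_u²`
(`c_u ∈ {1, 2, -2}`, `exists_gl_powFormLex_two_eq_diagonal`) the Borel translates of `h₀ · tr X_n²`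
are dense in `Δ_2(tr X_n²)` — hypothesis `hdense` of `rowTwo_bound_of_sign_of_fund` DISCHARGED.
[folklore] -/
theorem hdense_powFormLex_two (n : ℕ) (h₀ : GL (MatIdx n) ℂ)
    (hh₀ : linSubstRep (MatIdx n) ℂ h₀ (powFormLex ℂ n 2) =
      ∑ u : MatIdx n,
        (if (toLex ((ofLex u).2, (ofLex u).1) : MatIdx n) = u then (1 : ℂ)
          else if u < toLex ((ofLex u).2, (ofLex u).1) then 2 else -2) •
          (X u : MvPolynomial (MatIdx n) ℂ) ^ 2)
    (x : OrbitCoordRing (powFormLex ℂ n 2) 2)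
    (hx : ∀ b : GL (MatIdx n) ℂ, IsUpperTriangular b →
      evalAtPoint (powFormLex ℂ n 2) 2 (orbitCoordRep (powFormLex ℂ n 2) 2 (b * h₀)⁻¹ x) = 0) :
    x = 0 :=
  hdense_of_linSubstRep_eq_diagonal (powFormLex ℂ n 2) h₀ _
    (fun u => by split_ifs <;> norm_num) hh₀ x hx

end Density

end

end Summit.ValiantsHypothesis.ValiantsHypothesis.Theorems.GeneratorObstructions.PowGenDegreeQP
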